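import Literature.MathematicalPhysics.AQFT.OSAxiomsSchwinger
import Literature.MathematicalPhysics.QuantumLattice.SchwartzTensor
import Literature.MathematicalPhysics.QuantumLattice.EuclideanAction

/-!
# Crux `ContinuumLimitOnTrajectory` (stmt-QuantumFields-10522), line `two-orbit-synchronisation` (seat c2):
# axis rotations of multi-point test functions and support bookkeeping for `⁰𝒮`

Helper file (`--supports stmt-QuantumFields-10522`) for the registered stub `stub_uclOfGap : UCLOfGap` (skeleton v3.1).
The clustering leg turns the spatial translation of `UCL` into a TIME translation by permuting the lattice axes (exact
symmetry `AxisSymm`, stub `stub_axisSymmetry`). This file records the test-function side of that manoeuvre: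

* `linActMulti_appendTensor`, `linActMulti_translateMulti` — the diagonal action of a linear isometry commutes with appended
  tensors and intertwines translations (`R (T_a F) = T_{Ra} (R F)`); `piLpCongrLeft_apply_coord` — the coordinate permutation
  `(R_σ v)_j = v_{σ⁻¹ j}`;
* support bookkeeping: `tsupport` of `linActMulti`, `translateMulti`, `appendTensor`, `osAdjoint`;
* `AvoidsLocus F` (the support misses the coincidence locus — OS's `𝒮(ℝ^{4n}_0)`-supported functions; implies `IsOffDiagonal`,
  tree `IsOffDiagonal.of_tsupport_subset`): time-ordered functions and their OS adjoints avoid the locus, the property is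
  stable under the operations above and under shrinking the support, and two locus-avoiding factors SEPARATED BY A COORDINATE
  HYPERPLANE have a locus-avoiding appended tensor (`avoidsLocus_appendTensor_of_sep`) — which is how every cut, rotated and
  translated piece of `ΘF* ⊗ T_{ta} G` stays in `⁰𝒮` (where the uniform UV bounds apply).

Tree imports only; nothing about Wilson's theory is asserted. Refs: Osterwalder–Schrader 1973 §2.
-/

set_option autoImplicit false

open scoped SchwartzMap ComplexConjugate
open Filter Topology Set
open Literature.MathematicalPhysics.QuantumLattice Literature.MathematicalPhysics.AQFT

noncomputable section

namespace Summit.QuantumFields.YangMills.Cruxes.ContinuumLimitOnTrajectory.TwoOrbitSynchronisation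

local notation "𝔼" => EuclideanSpace ℝ (Fin 4)

/-! ## Rotations versus tensors and translations -/

section Algebra

variable {E : Type*} [NormedAddCommGroup E] [NormedSpace ℝ E] {n m : ℕ}

/-- The diagonal action commutes with appended tensors: `R (F ⊗ G') = R F ⊗ R G'`. -/
theorem linActMulti_appendTensor (L : E ≃ₗᵢ[ℝ] E) (F : 𝓢((Fin n → E), ℂ)) (G' : 𝓢((Fin m → E), ℂ)) :
    linActMulti L (F.appendTensor G') = (linActMulti L F).appendTensor (linActMulti L G') := by
  ext x
  simp only [linActMulti_apply, SchwartzMap.appendTensor_apply, Function.comp_def]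

/-- The diagonal action intertwines translations: `R (T_a F) = T_{R a} (R F)`. -/
theorem linActMulti_translateMulti (L : E ≃ₗᵢ[ℝ] E) (a : E) (F : 𝓢((Fin n → E), ℂ)) :
    linActMulti L (translateMulti a F) = translateMulti (L a) (linActMulti L F) := by
  ext x
  simp only [linActMulti_apply, translateMulti_apply, map_sub, LinearIsometryEquiv.symm_apply_apply]

end Algebra

/-- **Coordinates of the axis permutation**: `(R_σ v)_j = v_{σ⁻¹ j}` for `R_σ = piLpCongrLeft 2 ℝ ℝ σ`. -/
theorem piLpCongrLeft_apply_coord :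
    ∀ (σ : Equiv.Perm (Fin 4)) (v : EuclideanSpace ℝ (Fin 4)) (j : Fin 4),
      LinearIsometryEquiv.piLpCongrLeft 2 ℝ ℝ σ v j = v (σ.symm j) := by
  intro σ v j
  simp [LinearIsometryEquiv.piLpCongrLeft_apply, Equiv.piCongrLeft'_apply]

/-- The inverse axis permutation in coordinates: `(R_σ⁻¹ v)_j = v_{σ j}`. -/
theorem piLpCongrLeft_symm_apply_coord (σ : Equiv.Perm (Fin 4)) (v : 𝔼) (j : Fin 4) :
    (LinearIsometryEquiv.piLpCongrLeft 2 ℝ ℝ σ).symm v j = v (σ j) := by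
  rw [LinearIsometryEquiv.piLpCongrLeft_symm, piLpCongrLeft_apply_coord, Equiv.symm_symm]

/-! ## Supports -/

section Supports

variable {E : Type*} [NormedAddCommGroup E] [NormedSpace ℝ E] {n m : ℕ}

/-- Support of the rotated function. -/
theorem tsupport_linActMulti_subset_preimage (L : E ≃ₗᵢ[ℝ] E) (F : 𝓢((Fin n → E), ℂ)) :
    tsupport (linActMulti L F : (Fin n → E) → ℂ) ⊆ {x | (fun i => L.symm (x i)) ∈ tsupport (F : (Fin n → E) → ℂ)} := by
  have hc : Continuous fun x : Fin n → E => fun i => L.symm (x i) :=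
    continuous_pi fun i => L.symm.continuous.comp (continuous_apply i)
  have h := tsupport_comp_subset_preimage (F : (Fin n → E) → ℂ) hc
  have hcoe : ((linActMulti L F : 𝓢((Fin n → E), ℂ)) : (Fin n → E) → ℂ) =
      (F : (Fin n → E) → ℂ) ∘ fun x : Fin n → E => fun i => L.symm (x i) := by
    funext x; simp [linActMulti_apply]
  rw [hcoe]; exact h

/-- Support of the translated function. -/
theorem tsupport_translateMulti_subset_preimage (a : E) (F : 𝓢((Fin n → E), ℂ)) :
    tsupport (translateMulti a F : (Fin n → E) → ℂ) ⊆ {x | (fun i => x i - a) ∈ tsupport (F : (Fin n → E) → ℂ)} := by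
  have hc : Continuous fun x : Fin n → E => fun i => x i - a :=
    continuous_pi fun i => (continuous_apply i).sub continuous_const
  have h := tsupport_comp_subset_preimage (F : (Fin n → E) → ℂ) hc
  have hcoe : ((translateMulti a F : 𝓢((Fin n → E), ℂ)) : (Fin n → E) → ℂ) =
      (F : (Fin n → E) → ℂ) ∘ fun x : Fin n → E => fun i => x i - a := by
    funext x; simp [translateMulti_apply]
  rw [hcoe]; exact h

/-- Support of the appended tensor. -/
theorem tsupport_appendTensor_subset_preimage (F : 𝓢((Fin n → E), ℂ)) (G' : 𝓢((Fin m → E), ℂ)) :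
    tsupport (F.appendTensor G' : (Fin (n + m) → E) → ℂ) ⊆
      {x | x ∘ Fin.castAdd m ∈ tsupport (F : (Fin n → E) → ℂ) ∧ x ∘ Fin.natAdd n ∈ tsupport (G' : (Fin m → E) → ℂ)} := by
  have hcoe : ((F.appendTensor G' : 𝓢((Fin (n + m) → E), ℂ)) : (Fin (n + m) → E) → ℂ) =
      ((F : (Fin n → E) → ℂ) ∘ fun x : Fin (n + m) → E => x ∘ Fin.castAdd m) *
        ((G' : (Fin m → E) → ℂ) ∘ fun x : Fin (n + m) → E => x ∘ Fin.natAdd n) := by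
    funext x; simp [SchwartzMap.appendTensor_apply]
  rw [hcoe]
  intro x hx
  have h1 := tsupport_mul_subset_left hx
  have h2 := tsupport_mul_subset_right hx
  have hc1 : Continuous fun x : Fin (n + m) → E => x ∘ Fin.castAdd m := by fun_prop
  have hc2 : Continuous fun x : Fin (n + m) → E => x ∘ Fin.natAdd n := by fun_prop
  exact ⟨tsupport_comp_subset_preimage _ hc1 h1, tsupport_comp_subset_preimage _ hc2 h2⟩

/-- Support of the OS adjoint (`d = 4`). -/
theorem tsupport_osAdjoint_subset_preimage (F : 𝓢((Fin n → 𝔼), ℂ)) :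
    tsupport (osAdjoint F : (Fin n → 𝔼) → ℂ) ⊆
      {x | (fun i => timeReflection 4 (x (Fin.rev i))) ∈ tsupport (F : (Fin n → 𝔼) → ℂ)} := by
  have hc : Continuous fun x : Fin n → 𝔼 => fun i => timeReflection 4 (x (Fin.rev i)) :=
    continuous_pi fun i => (timeReflection 4).continuous.comp (continuous_apply _)
  have h := tsupport_comp_subset_preimage (fun y => conj ((F : (Fin n → 𝔼) → ℂ) y)) hc
  have hcoe : ((osAdjoint F : 𝓢((Fin n → 𝔼), ℂ)) : (Fin n → 𝔼) → ℂ) =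
      (fun y => conj ((F : (Fin n → 𝔼) → ℂ) y)) ∘ fun x : Fin n → 𝔼 => fun i => timeReflection 4 (x (Fin.rev i)) := by
    funext x; simp [osAdjoint_apply]
  rw [hcoe]
  refine h.trans fun x hx => ?_
  have hsub : tsupport (fun y => conj ((F : (Fin n → 𝔼) → ℂ) y)) ⊆ tsupport (F : (Fin n → 𝔼) → ℂ) :=
    closure_mono fun y hy => by simpa [Function.mem_support] using hy
  exact hsub hx

end Supports

/-! ## Avoiding the coincidence locus -/

section Avoids

variable {E : Type*} [NormedAddCommGroup E] [NormedSpace ℝ E] {n m : ℕ}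

/-- **The support misses the coincidence locus** (OS's `𝒮(ℝ^{dn}_0)`-supported functions). -/
def AvoidsLocus (F : 𝓢((Fin n → E), ℂ)) : Prop :=
  tsupport (F : (Fin n → E) → ℂ) ⊆ (coincidenceLocus n E)ᶜ

/-- Locus-avoiding functions are in `⁰𝒮`. -/
theorem AvoidsLocus.isOffDiagonal {F : 𝓢((Fin n → E), ℂ)} (h : AvoidsLocus F) : IsOffDiagonal F :=
  IsOffDiagonal.of_tsupport_subset h

/-- Shrinking the support preserves locus-avoidance. -/
theorem AvoidsLocus.of_tsupport_subset {F F' : 𝓢((Fin n → E), ℂ)} (h : AvoidsLocus F)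
    (hsub : tsupport (F' : (Fin n → E) → ℂ) ⊆ tsupport (F : (Fin n → E) → ℂ)) : AvoidsLocus F' :=
  hsub.trans h

/-- Rotations preserve locus-avoidance. -/
theorem AvoidsLocus.linActMulti {F : 𝓢((Fin n → E), ℂ)} (h : AvoidsLocus F) (L : E ≃ₗᵢ[ℝ] E) :
    AvoidsLocus (linActMulti L F) := by
  intro x hx hxl
  have hx' := tsupport_linActMulti_subset_preimage L F hx
  obtain ⟨i, j, hij, hxij⟩ := hxl
  exact h hx' ⟨i, j, hij, by simp [hxij]⟩

/-- Translations preserve locus-avoidance. -/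
theorem AvoidsLocus.translateMulti {F : 𝓢((Fin n → E), ℂ)} (h : AvoidsLocus F) (a : E) :
    AvoidsLocus (translateMulti a F) := by
  intro x hx hxl
  have hx' := tsupport_translateMulti_subset_preimage a F hx
  obtain ⟨i, j, hij, hxij⟩ := hxl
  exact h hx' ⟨i, j, hij, by simp [hxij]⟩

/-- **Time-ordered test functions avoid the locus** (their points have strictly increasing times on the support). -/
theorem avoidsLocus_of_isTimeOrdered {F : 𝓢((Fin n → 𝔼), ℂ)} (hF : IsTimeOrdered F) : AvoidsLocus F := by
  intro x hx hxl
  obtain ⟨i, j, hij, hxij⟩ := hxl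
  have hmono := (hF hx).2
  exact hij (hmono.injective (by rw [hxij]))

/-- OS adjoints of time-ordered functions avoid the locus. -/
theorem avoidsLocus_osAdjoint_of_isTimeOrdered {F : 𝓢((Fin n → 𝔼), ℂ)} (hF : IsTimeOrdered F) : AvoidsLocus (osAdjoint F) := by
  intro x hx hxl
  have hx' := tsupport_osAdjoint_subset_preimage F hx
  obtain ⟨i, j, hij, hxij⟩ := hxl
  have hmono := (hF hx').2
  have : Fin.rev i = Fin.rev j := hmono.injective (by simp [hxij])
  exact hij (Fin.rev_injective this)

/-- OS adjoints of time-ordered functions live at NEGATIVE times. -/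
theorem tsupport_osAdjoint_subset_neg {F : 𝓢((Fin n → 𝔼), ℂ)} (hF : IsTimeOrdered F) :
    tsupport (osAdjoint F : (Fin n → 𝔼) → ℂ) ⊆ {x | ∀ j, x j 0 < 0} := by
  intro x hx j
  have hx' := tsupport_osAdjoint_subset_preimage F hx
  have hpos := (hF hx').1 (Fin.rev j)
  simp only [Fin.rev_rev, timeReflection_apply, if_true] at hpos
  linarith

/-- Time-ordered functions live at POSITIVE times. -/
theorem tsupport_subset_pos_of_isTimeOrdered {F : 𝓢((Fin n → 𝔼), ℂ)} (hF : IsTimeOrdered F) :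
    tsupport (F : (Fin n → 𝔼) → ℂ) ⊆ {x | ∀ j, 0 < x j 0} := fun _ hx j => (hF hx).1 j

/-- **Separated locus-avoiding factors have a locus-avoiding tensor product.** If `F` and `G'` avoid their loci and
their supports are separated by the coordinate hyperplane `{v_crd = c}`, then `F ⊗ G'` avoids the locus of `n + m` points. -/
theorem avoidsLocus_appendTensor_of_sep {F : 𝓢((Fin n → 𝔼), ℂ)} {G' : 𝓢((Fin m → 𝔼), ℂ)} (hF : AvoidsLocus F)
    (hG : AvoidsLocus G') (crd : Fin 4) (c : ℝ) (hFc : tsupport (F : (Fin n → 𝔼) → ℂ) ⊆ {x | ∀ j, x j crd < c})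
    (hGc : tsupport (G' : (Fin m → 𝔼) → ℂ) ⊆ {y | ∀ j, c < y j crd}) : AvoidsLocus (F.appendTensor G') := by
  intro x hx hxl
  obtain ⟨h1, h2⟩ := tsupport_appendTensor_subset_preimage F G' hx
  obtain ⟨i, j, hij, hxij⟩ := hxl
  induction i using Fin.addCases with
  | left i =>
    induction j using Fin.addCases with
    | left j =>
      refine hF h1 ⟨i, j, fun h => hij (by rw [h]), ?_⟩
      simpa [Function.comp_def] using hxij
    | right j =>
      have a1 := hFc h1 i
      have a2 := hGc h2 j
      simp only [Function.comp_apply] at a1 a2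
      rw [hxij] at a1
      linarith
  | right i =>
    induction j using Fin.addCases with
    | left j =>
      have a1 := hGc h2 i
      have a2 := hFc h1 j
      simp only [Function.comp_apply] at a1 a2
      rw [hxij] at a1
      linarith
    | right j =>
      refine hG h2 ⟨i, j, fun h => hij (by rw [h]), ?_⟩
      simpa [Function.comp_def] using hxij

end Avoids

/-! ## The rotated supports -/

/-- After the axis permutation `σ`, a support in `{x_j crd' < c}` (old coordinate `crd'`) lies in `{x_j (σ crd') < c}`?? — precisely:
`tsupport (R_σ F) ⊆ {x | ∀ j, x j (σ crd') … }` follows from `(R_σ⁻¹ x_j)_{crd'} = x_j (σ crd')`. -/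
theorem tsupport_linActMulti_piLpCongrLeft_subset {n : ℕ} (σ : Equiv.Perm (Fin 4)) (F : 𝓢((Fin n → 𝔼), ℂ))
    {P : ℝ → Prop} (crd' : Fin 4) (hF : tsupport (F : (Fin n → 𝔼) → ℂ) ⊆ {x | ∀ j, P (x j crd')}) :
    tsupport (linActMulti (LinearIsometryEquiv.piLpCongrLeft 2 ℝ ℝ σ) F : (Fin n → 𝔼) → ℂ) ⊆ {x | ∀ j, P (x j (σ crd'))} := by
  intro x hx j
  have hx' := tsupport_linActMulti_subset_preimage _ F hx
  have := hF hx' j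
  simpa [piLpCongrLeft_symm_apply_coord] using this

/-- Translating by a vector with vanishing `crd`-component keeps a `crd`-half-space support. -/
theorem tsupport_translateMulti_subset_of_coord_eq_zero {n : ℕ} (a : 𝔼) (crd : Fin 4) (ha : a crd = 0)
    (F : 𝓢((Fin n → 𝔼), ℂ)) {P : ℝ → Prop} (hF : tsupport (F : (Fin n → 𝔼) → ℂ) ⊆ {x | ∀ j, P (x j crd)}) :
    tsupport (translateMulti a F : (Fin n → 𝔼) → ℂ) ⊆ {x | ∀ j, P (x j crd)} := by
  intro x hx j
  have hx' := tsupport_translateMulti_subset_preimage a F hx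
  have := hF hx' j
  simpa [ha] using this

/-- **A nonzero spatial vector has a nonzero spatial coordinate.** -/
theorem exists_coord_ne_zero {a : 𝔼} (ha0 : a 0 = 0) (ha : a ≠ 0) : ∃ i : Fin 4, i ≠ 0 ∧ a i ≠ 0 := by
  by_contra h
  push Not at h
  apply ha
  ext i
  by_cases hi : i = 0
  · subst hi; simpa using ha0
  · simpa using h i hi

end Summit.QuantumFields.YangMills.Cruxes.ContinuumLimitOnTrajectory.TwoOrbitSynchronisation

end
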